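import Summits.Ventures.PercRepro.S1FiveCircuitBase
import Summits.Ventures.PercRepro.RankLevelSetFourCircuitNullityFour
import Summits.Ventures.PercRepro.TriangleCapEightI

/-!
# PercRepro — THE LAST AVERAGING STEP AT THE CELL'S OWN POINT COUNT (p2, gen 21; SUBCLAIM-S1 §6.5)

The averaging chains (`cq3`, `avgChain16`, `avgChain5b`) take each step with the LEAST number of non-coloops a core
of that nullity can have. On a COLOOP-FREE core with `n` points every point is a non-coloop, so the last step may
be taken with `m = n`: some point `x` lies on at most `⌊k·s_k/n⌋` `k`-circuits, `M ＼ {x}` is a core of nullity one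
less, and `s_k ≤ ⌊n·B_k(d − 1)/(n − k)⌋` where `B_k(d − 1)` is the chain's value one level down. At `(11, 5)`
(`n = 16`): `s₃ ≤ ⌊16·5/13⌋ = 6`, `s₄ ≤ ⌊16·16/12⌋ = 21`, `s₅ ≤ ⌊16·52/11⌋ = 75` against the chains' `7 / 28 / 117`.

* `le_mul_div_of_sub_div_le_three` — the arithmetic of one step for `k = 3`;
* **`ncard_triangles_le_of_coloopFree`**, **`ncard_fourCircuits_le_of_coloopFree`**, **`ncard_fiveCircuits_le_of_coloopFree`**.
Axioms: standard.
-/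

open scoped Matroid

namespace PercRepro

namespace S1

open Set

variable {α : Type}

/-- `s − ⌊3s/m⌋ ≤ B` with `m > 3` gives `s ≤ ⌊m·B/(m − 3)⌋`. -/
theorem le_mul_div_of_sub_div_le_three {s B m : ℕ} (hm : 3 < m) (h : s - 3 * s / m ≤ B) :
    s ≤ m * B / (m - 3) := by
  have h1 : s ≤ B + 3 * s / m := by omega
  have h2 : m * (3 * s / m) ≤ 3 * s := Nat.mul_div_le (3 * s) m
  have h3 : m * s ≤ m * B + 3 * s := by nlinarith [Nat.mul_le_mul_left m h1]
  have h4 : (m - 3) * s ≤ m * B := by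
    have : (m - 3) * s = m * s - 3 * s := by rw [Nat.sub_mul]
    omega
  exact (Nat.le_div_iff_mul_le (by omega)).2 (by rw [mul_comm]; exact h4)

/-- On a coloop-free matroid the non-coloops are the whole ground set. -/
theorem ncard_nonColoops_of_coloops_eq_empty (M : Matroid α) (hcol : M.coloops = ∅) :
    (M.E \ M.coloops).ncard = M.E.ncard := by
  rw [hcol, Set.sdiff_empty]

/-- **The triangle lever**: a coloop-free `e`-free core of nullity `d + 1` on `n > 3` points has
`s₃ ≤ ⌊n·cq3 d/(n − 3)⌋`. -/
theorem ncard_triangles_le_of_coloopFree (M : Matroid α) [M.Finite]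
    (hfree : ∀ e ∈ M.E, ∃ A ⊆ M.E \ {e}, e ∉ M.closure A ∧ e ∉ M.closure ((M.E \ {e}) \ A))
    {d : ℕ} (hd : M.E.encard = M.eRank + ((d + 1 : ℕ) : ℕ∞)) (hcol : M.coloops = ∅)
    {n : ℕ} (hn : M.E.ncard = n) (hn3 : 3 < n) :
    {C : Set α | M.IsCircuit C ∧ C.ncard = 3}.ncard ≤ n * TriangleCap.cq3 d / (n - 3) := by
  classical
  have hL : ∀ e ∈ M.E, ¬ M.IsLoop e := ThmN.not_isLoop_of_free M hfree
  have hC1 : ∀ L ⊆ M.E, M.eRk L = 2 → L.ncard ≤ 3 := by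
    intro L hL' hr
    have := ThmN.ncard_add_one_le_two_pow_of_eRk_le M hL hfree 2 L hL' hr.le
    omega
  have hC2 : ∀ P ⊆ M.E, M.eRk P ≤ 3 → P.ncard ≤ 6 := fun P hP hr =>
    ThmN.ncard_le_six_of_eRk_le_three_of_free M hfree hP hr
  apply le_mul_div_of_sub_div_le_three hn3
  rcases Nat.eq_zero_or_pos (ThmN.triangles M).ncard with h0 | hpos
  · change (ThmN.triangles M).ncard - 3 * (ThmN.triangles M).ncard / n ≤ _
    rw [h0]; simp
  -- a point of degree `≤ ⌊3·s₃/n⌋`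
  obtain ⟨x, hxE, hx⟩ : ∃ x ∈ M.E,
      (ThmN.trianglesThrough M x).ncard ≤ 3 * (ThmN.triangles M).ncard / M.E.ncard := by
    by_contra hno
    have hall : ∀ x ∈ M.E,
        3 * (ThmN.triangles M).ncard / M.E.ncard + 1 ≤ (ThmN.trianglesThrough M x).ncard := by
      intro x hx
      by_contra h
      exact hno ⟨x, hx, by omega⟩
    have h1 := mul_ncard_ground_le_three_mul_ncard_triangles M
      (3 * (ThmN.triangles M).ncard / M.E.ncard + 1) hall
    have h2 : 3 * (ThmN.triangles M).ncard <
        (3 * (ThmN.triangles M).ncard / M.E.ncard + 1) * M.E.ncard :=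
      Nat.lt_mul_of_div_lt (Nat.lt_succ_self _) (by omega)
    omega
  have hne : ¬ M.IsColoop x := by
    rw [Matroid.isColoop_iff_mem_coloops, hcol]
    exact Set.notMem_empty x
  obtain ⟨hd', -, -, hle⟩ := ncard_triangles_le_add_of_not_isColoop M hC1 hC2 (d := d) hd hxE hne
  have hrec : (ThmN.triangles (M ＼ {x})).ncard ≤ TriangleCap.cq3 d :=
    TriangleCap.core_ncard_triangles_le_cq3 (M ＼ {x}) (hfree_delete M hfree x) hd'
  rw [hn] at hx
  change (ThmN.triangles M).ncard - 3 * (ThmN.triangles M).ncard / n ≤ _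
  omega

/-- **The four-circuit lever**: a coloop-free `e`-free core of nullity `d + 1` on `n > 4` points has
`s₄ ≤ ⌊n·avgChain16 d/(n − 4)⌋`. -/
theorem ncard_fourCircuits_le_of_coloopFree (M : Matroid α) [M.Finite]
    (hfree : ∀ e ∈ M.E, ∃ A ⊆ M.E \ {e}, e ∉ M.closure A ∧ e ∉ M.closure ((M.E \ {e}) \ A))
    {d : ℕ} (hd : M.E.encard = M.eRank + (d + 1)) (hcol : M.coloops = ∅)
    {n : ℕ} (hn : M.E.ncard = n) (hn4 : 4 < n) :
    {C : Set α | M.IsCircuit C ∧ C.ncard = 4}.ncard ≤ n * ThmN.avgChain16 d / (n - 4) := by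
  have hm : n ≤ (M.E \ M.coloops).ncard := by
    rw [ncard_nonColoops_of_coloops_eq_empty M hcol, hn]
  have h := ncard_fourCircuits_sub_div_le_of_nonColoops M hfree hd (by omega) hm
    (B := ThmN.avgChain16 d)
    (fun M' _ hfree' hd' => ThmN.ncard_fourCircuits_le_avgChain16 d M' hfree' hd')
  exact le_mul_div_of_sub_div_le hn4 h

/-- **The five-circuit lever**: a coloop-free `e`-free core of nullity `d + 1` on `n > 5` points has
`s₅ ≤ ⌊n·avgChain5b d/(n − 5)⌋`. -/
theorem ncard_fiveCircuits_le_of_coloopFree (M : Matroid α) [M.Finite]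
    (hfree : ∀ e ∈ M.E, ∃ A ⊆ M.E \ {e}, e ∉ M.closure A ∧ e ∉ M.closure ((M.E \ {e}) \ A))
    {d : ℕ} (hd : M.E.encard = M.eRank + (d + 1)) (hcol : M.coloops = ∅)
    {n : ℕ} (hn : M.E.ncard = n) (hn5 : 5 < n) :
    {C : Set α | M.IsCircuit C ∧ C.ncard = 5}.ncard ≤ n * avgChain5b d / (n - 5) := by
  have hm : n ≤ (M.E \ M.coloops).ncard := by
    rw [ncard_nonColoops_of_coloops_eq_empty M hcol, hn]
  have h := ncard_fiveCircuits_sub_div_le_of_nonColoops M hfree hd (by omega) hm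
    (B := avgChain5b d)
    (fun M' _ hfree' hd' => ncard_fiveCircuits_le_avgChain5b d M' hfree' hd')
  exact le_mul_div_of_sub_div_le_five hn5 h

end S1

end PercRepro
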